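import Literature.NumberTheory.GaloisRepresentations.ContinuousRepHomModules
import Literature.NumberTheory.GaloisRepresentations.SUnitsRestrictedKummer
import Literature.NumberTheory.GaloisRepresentations.RestrictedRamificationKummer
import Literature.NumberTheory.GaloisRepresentations.TateDualHomUnits
import Literature.NumberTheory.GaloisRepresentations.TateDualityCounting
import Literature.NumberTheory.GaloisCohomology.PoitouTateRestrictedRamification

/-!
# `(M^D)^{N_S} ≅ Hom_ℤ(M^{N_S}, E_S)` — the Tate dual of a finite `G_S`-module read in the `S`-units

The `S`-version of the identification `ρ^∨(1) = Hom(M, μₙ) ≅ Hom_ℤ(M, K̄ˣ)` of the Hom-dual road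
(`HomDual.tateDualUnitsIso`, Milne I §0 (0.8) with I §4: for the restricted-ramification duality theorem the
pair `(G_S, E_S = 𝒪_{K_S,S}^×)` replaces `(Γ_K, K̄ˣ)`).

Let `K` be a number field, `S` a set of finite places, `N_S = ramificationSubgroup K S`, `G_S = Γ_K ⧸ N_S`
(`GaloisGroupUnramifiedOutside K S`), `E_S` the continuous `G_S`-module of `N_S`-fixed `S`-units of `K̄`
(`SUnits.sUnitsRestricted K S`), `ρ : Γ_K → Aut(M)` a finite discrete Galois module, `M^{N_S}` its `G_S`-module of
`N_S`-invariants (`quotientInvariants`) and `M^D = Hom(M, μₙ)` its Tate dual (`ρ.tateDual n`).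

* §1 `kummerInclAddHom_mem_sUnitsSubmodule`, `units_kummerInclAddHom_eq_self`, `muToSUnitsRestricted` — when every
  prime dividing `n` lies in `S`, `μₙ(K̄) ⊆ E_S`: a root of unity is an `S`-unit fixed by `N_S`
  (`SUnits.root_mem_sUnits`, `smul_units_eq_self_of_mem_ramificationSubgroup`).
* §2 `tateDualToHomSUnits` — `Φ_S : (M^D)^{N_S} → Hom_ℤ(M^{N_S}, E_S)`, `f ↦ (m ↦ ι (f m))`, and its
  `G_S`-equivariance `tateDualToHomSUnits_smul` for the actions `(ρ.tateDual n).quotientInvariants N_S` and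
  `ContHomDual.homContRep (ρ.quotientInvariants N_S) (sUnitsRestricted K S)`.
* §3 `tateDualToHomSUnits_bijective` — for `M` unramified outside `S` (`N_S ≤ ker ρ`, so `M^{N_S} = M`) and
  `n`-torsion, `Φ_S` is bijective (inverse through `HomDual.homMuUnitsInv`: an additive `M → E_S` lands in
  `E_S[n] = μₙ`).
* §4 `tateDualSUnitsRestrictedIso` — **`(ρ^D)^{N_S} ≅ Hom_ℤ(M^{N_S}, E_S)` in `TopRep ℤ G_S`**, with the induced
  bijections on `Hⁱ(G_S, –)` (`restrictedCohomology (ρ.tateDual n) S i` on the left).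

References: J. S. Milne, *Arithmetic Duality Theorems* (2006), I §0 (0.8), I §4 (proof of Thm. 4.10, p. 58);
J. Neukirch, A. Schmidt, K. Wingberg, *Cohomology of Number Fields* (2008), VIII §3 ((8.3.18): `μ_p ⊂ 𝒪_S^×`);
D. Harari, *Galois Cohomology and Class Field Theory* (2020), §17.4.
-/

open CategoryTheory Function Field NumberField IsDedekindDomain

noncomputable section

namespace Literature.NumberTheory.GaloisRepresentations

namespace ContHomDual

open Literature.Algebra.Homology DiscreteGaloisModule SUnits HomDual ContRepresentation

variable (K : Type) [Field K] [NumberField K] (S : Set (HeightOneSpectrum (𝓞 K))) (n : ℕ) [NeZero n]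
variable {M : Type} [AddCommGroup M] [TopologicalSpace M] [DiscreteTopology M] [Finite M]

/-! ## §1 Roots of unity are `N_S`-fixed `S`-units -/

/-- `ι ζ ∈ E_S`: a root of unity of `K̄` is an `S`-unit (a root of the `S`-unit `1`).
[cite: NeukirchSchmidtWingberg2008, VIII §3 (proof of (8.3.18))] -/
theorem kummerInclAddHom_mem_sUnitsSubmodule (ζ : MuCarrier K n) :
    kummerInclAddHom K n ζ ∈ sUnitsSubmodule K S := by
  rw [mem_sUnitsSubmodule_iff]
  change unitsVal K (kummerInclAddHom K n ζ) ∈ sUnits K S (AlgebraicClosure K)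
  rw [unitsVal_kummerInclAddHom]
  exact root_mem_sUnits (NeZero.pos n) (muVal_pow_eq_one K n ζ) (sUnits K S (AlgebraicClosure K)).one_mem

/-- `N_S` fixes `ι ζ` for `ζ ∈ μₙ` when every prime dividing `n` lies in `S` (`K(μₙ)/K` is unramified outside `n`).
[cite: NeukirchSchmidtWingberg2008, VIII §3 (proof of (8.3.18))] -/
theorem units_kummerInclAddHom_eq_self
    (hn : ∀ v : HeightOneSpectrum (𝓞 K), ((n : ℕ) : 𝓞 K) ∈ v.asIdeal → v ∈ S)
    {τ : absoluteGaloisGroup K} (hτ : τ ∈ ramificationSubgroup K S) (ζ : MuCarrier K n) :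
    units K τ (kummerInclAddHom K n ζ) = kummerInclAddHom K n ζ := by
  apply unitsVal_injective K
  rw [unitsVal_apply, unitsVal_kummerInclAddHom]
  exact Units.ext (by
    rw [Units.coe_smul]
    exact smul_units_eq_self_of_mem_ramificationSubgroup hn (muVal K n ζ) (muVal_pow_eq_one K n ζ) τ hτ)

/-- **`μₙ(K̄) → E_S`, `ζ ↦ ι ζ`**, as an additive map into the carrier of `sUnitsRestricted K S` (the `N_S`-invariants
of the `S`-units), for `n` with all its prime divisors in `S`. [cite: NeukirchSchmidtWingberg2008, VIII §3 (8.3.18)]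
[cite: MilneADT2006, I §4 (p. 58)] -/
def muToSUnitsRestricted (hn : ∀ v : HeightOneSpectrum (𝓞 K), ((n : ℕ) : 𝓞 K) ∈ v.asIdeal → v ∈ S) :
    MuCarrier K n →+
      ↥(Representation.invariants ((sUnitsModule K S).toRepresentation.comp (ramificationSubgroup K S).subtype)) where
  toFun ζ := ⟨⟨kummerInclAddHom K n ζ, kummerInclAddHom_mem_sUnitsSubmodule K S n ζ⟩, fun τ => Subtype.ext (by
      change units K (τ : absoluteGaloisGroup K) (kummerInclAddHom K n ζ) = kummerInclAddHom K n ζ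
      exact units_kummerInclAddHom_eq_self K S n hn τ.2 ζ)⟩
  map_zero' := Subtype.ext (Subtype.ext (map_zero (kummerInclAddHom K n)))
  map_add' ζ ζ' := Subtype.ext (Subtype.ext (map_add (kummerInclAddHom K n) ζ ζ'))

/-- Unfolding `muToSUnitsRestricted` down to `K̄ˣ` (additively written): it is the Kummer inclusion.
[cite: MilneADT2006, I §4 (p. 58)] -/
@[simp] theorem coe_coe_muToSUnitsRestricted
    (hn : ∀ v : HeightOneSpectrum (𝓞 K), ((n : ℕ) : 𝓞 K) ∈ v.asIdeal → v ∈ S) (ζ : MuCarrier K n) :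
    (((muToSUnitsRestricted K S n hn ζ :
        Representation.invariants ((sUnitsModule K S).toRepresentation.comp (ramificationSubgroup K S).subtype)) :
        sUnitsSubmodule K S) : UnitsCarrier K) = kummerInclAddHom K n ζ := rfl

/-- `ζ ↦ ι ζ : μₙ → E_S` is injective. [cite: MilneADT2006, I §4 (p. 58)] -/
theorem muToSUnitsRestricted_injective
    (hn : ∀ v : HeightOneSpectrum (𝓞 K), ((n : ℕ) : 𝓞 K) ∈ v.asIdeal → v ∈ S) :
    Injective (muToSUnitsRestricted K S n hn) := fun ζ ζ' h =>
  kummerInclAddHom_injective K n (by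
    rw [← coe_coe_muToSUnitsRestricted K S n hn ζ, ← coe_coe_muToSUnitsRestricted K S n hn ζ', h])

/-! ## §2 `Φ_S : (M^D)^{N_S} → Hom_ℤ(M^{N_S}, E_S)` and its `G_S`-equivariance -/

/-- **`Φ_S : (M^D)^{N_S} → Hom_ℤ(M^{N_S}, E_S)`, `f ↦ (m ↦ ι (f m))`** (additive in `f`).
[cite: MilneADT2006, I §0 (0.8), I §4 (p. 58)] -/
def tateDualToHomSUnits (ρ : DiscreteGaloisModule K M) (hn : ∀ v : HeightOneSpectrum (𝓞 K), ((n : ℕ) : 𝓞 K) ∈ v.asIdeal → v ∈ S) :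
    ↥(Representation.invariants ((ρ.tateDual n).toRepresentation.comp (ramificationSubgroup K S).subtype)) →+
      DiscreteRep.HomCarrier
        ↥(Representation.invariants (ρ.toRepresentation.comp (ramificationSubgroup K S).subtype))
        ↥(Representation.invariants ((sUnitsModule K S).toRepresentation.comp (ramificationSubgroup K S).subtype)) where
  toFun f := ((muToSUnitsRestricted K S n hn).comp
      ((show M →+ MuCarrier K n from (f : TateDual K M n)).comp
        (Representation.invariants (ρ.toRepresentation.comp (ramificationSubgroup K S).subtype)).subtype.toAddMonoidHom)).toIntLinearMap
  map_zero' := LinearMap.ext fun m => by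
    change muToSUnitsRestricted K S n hn 0 = 0
    exact map_zero _
  map_add' f g := LinearMap.ext fun m => by
    change muToSUnitsRestricted K S n hn ((show M →+ MuCarrier K n from (f : TateDual K M n)) (m : M) +
        (show M →+ MuCarrier K n from (g : TateDual K M n)) (m : M)) = _
    rw [map_add]
    rfl

/-- Unfolding `Φ_S` down to `K̄ˣ`: `(Φ_S f) m = ι (f m)`. [cite: MilneADT2006, I §0 (0.8)] -/
@[simp] theorem coe_coe_tateDualToHomSUnits_apply (ρ : DiscreteGaloisModule K M)
    (hn : ∀ v : HeightOneSpectrum (𝓞 K), ((n : ℕ) : 𝓞 K) ∈ v.asIdeal → v ∈ S)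
    (f : Representation.invariants ((ρ.tateDual n).toRepresentation.comp (ramificationSubgroup K S).subtype))
    (m : Representation.invariants (ρ.toRepresentation.comp (ramificationSubgroup K S).subtype)) :
    ((((show _ →ₗ[ℤ] _ from tateDualToHomSUnits K S n ρ hn f) m :
        Representation.invariants ((sUnitsModule K S).toRepresentation.comp (ramificationSubgroup K S).subtype)) :
        sUnitsSubmodule K S) : UnitsCarrier K) =
      kummerInclAddHom K n ((show M →+ MuCarrier K n from (f : TateDual K M n)) (m : M)) := rfl

/-- **`Φ_S` is `G_S`-equivariant**: `Φ_S (σ f σ⁻¹) = σ ∘ Φ_S f ∘ σ⁻¹` for the `G_S`-actions `(ρ^D)^{N_S}`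
(`quotientInvariants`) and `Hom_ℤ(M^{N_S}, E_S)` (`homContRep`). [cite: MilneADT2006, I §0 (0.8), I §4 (p. 58)] -/
theorem tateDualToHomSUnits_smul (ρ : DiscreteGaloisModule K M)
    (hn : ∀ v : HeightOneSpectrum (𝓞 K), ((n : ℕ) : 𝓞 K) ∈ v.asIdeal → v ∈ S)
    (g : GaloisGroupUnramifiedOutside K S)
    (f : Representation.invariants ((ρ.tateDual n).toRepresentation.comp (ramificationSubgroup K S).subtype)) :
    tateDualToHomSUnits K S n ρ hn ((ρ.tateDual n).quotientInvariants (ramificationSubgroup K S) g f) =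
      homContRep (ρ.quotientInvariants (ramificationSubgroup K S)) (sUnitsRestricted K S) g
        (tateDualToHomSUnits K S n ρ hn f) := by
  induction g using QuotientGroup.induction_on with
  | H σ =>
    refine LinearMap.ext fun m => Subtype.ext (Subtype.ext (unitsVal_injective K ?_))
    rw [homContRep_apply]
    change unitsVal K (kummerInclAddHom K n (ρ.tateDual n σ (f : TateDual K M n) (m : M))) =
      unitsVal K (units K σ (kummerInclAddHom K n ((show M →+ MuCarrier K n from (f : TateDual K M n))
        (ρ σ⁻¹ (m : M)))))
    rw [unitsVal_kummerInclAddHom, unitsVal_apply, unitsVal_kummerInclAddHom, tateDual_apply_apply_apply]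
    rfl

/-! ## §3 Bijectivity for `M` unramified outside `S` and `n`-torsion -/

/-- `Φ_S` is injective when `N_S` acts trivially on `M` (`M^{N_S} = M`). [cite: MilneADT2006, I §0 (0.8), I §4 (p. 58)] -/
theorem tateDualToHomSUnits_injective (ρ : DiscreteGaloisModule K M)
    (hn : ∀ v : HeightOneSpectrum (𝓞 K), ((n : ℕ) : 𝓞 K) ∈ v.asIdeal → v ∈ S)
    (hur : ramificationSubgroup K S ≤ ContinuousRep.ker ρ) :
    Injective (tateDualToHomSUnits K S n ρ hn) := by
  intro f g h
  refine Subtype.ext (TateDual.ext fun m => ?_)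
  have hm : m ∈ Representation.invariants (ρ.toRepresentation.comp (ramificationSubgroup K S).subtype) := by
    rw [ρ.invariants_ramificationSubgroup_eq_top hur]
    trivial
  have h1 := congrArg (fun F => unitsVal K ((((show _ →ₗ[ℤ] _ from F) ⟨m, hm⟩ :
      Representation.invariants ((sUnitsModule K S).toRepresentation.comp (ramificationSubgroup K S).subtype)) :
      sUnitsSubmodule K S) : UnitsCarrier K)) h
  simp only [coe_coe_tateDualToHomSUnits_apply, unitsVal_kummerInclAddHom] at h1
  exact muVal_injective K n h1

omit [NeZero n] in
/-- An additive map `P → E_S` from an `n`-torsion group `P` takes values in `n`-th roots of unity.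
[cite: MilneADT2006, I §0 (0.8)] -/
theorem unitsVal_pow_eq_one_of_torsion' {P : Type} [AddCommGroup P] (hP : ∀ x : P, n • x = 0)
    (F : P →ₗ[ℤ]
      ↥(Representation.invariants ((sUnitsModule K S).toRepresentation.comp (ramificationSubgroup K S).subtype)))
    (x : P) :
    unitsVal K (((F x :
        Representation.invariants ((sUnitsModule K S).toRepresentation.comp (ramificationSubgroup K S).subtype)) :
        sUnitsSubmodule K S) : UnitsCarrier K) ^ n = 1 := by
  rw [← unitsVal_nsmul]
  change unitsVal K ((((n • F x) :
        Representation.invariants ((sUnitsModule K S).toRepresentation.comp (ramificationSubgroup K S).subtype)) :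
        sUnitsSubmodule K S) : UnitsCarrier K) = 1
  rw [← map_nsmul, hP, map_zero]
  rfl

omit [NeZero n] [Finite M] [NumberField K] in
/-- The `N_S`-invariants of an `n`-torsion `M` are `n`-torsion. [cite: MilneADT2006, I §0 (0.8), I §4 (p. 58)] -/
theorem nsmul_invariants_eq_zero (ρ : DiscreteGaloisModule K M) (hM : ∀ m : M, n • m = 0)
    (m : Representation.invariants (ρ.toRepresentation.comp (ramificationSubgroup K S).subtype)) : n • m = 0 :=
  Subtype.ext (by rw [Submodule.coe_smul_of_tower, hM]; rfl)

/-- The inverse of `Φ_S` on carriers: `F ↦ (m ↦ the root of unity (F m))` (`M` `n`-torsion, `N_S ≤ ker ρ`).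
[cite: MilneADT2006, I §0 (0.8), I §4 (p. 58)] -/
def tateDualOfHomSUnits (ρ : DiscreteGaloisModule K M) (hM : ∀ m : M, n • m = 0) (hur : ramificationSubgroup K S ≤ ContinuousRep.ker ρ)
    (F : ↥(Representation.invariants (ρ.toRepresentation.comp (ramificationSubgroup K S).subtype)) →ₗ[ℤ]
      ↥(Representation.invariants ((sUnitsModule K S).toRepresentation.comp (ramificationSubgroup K S).subtype))) :
    TateDual K M n :=
  show M →+ MuCarrier K n from
  { toFun := fun m => muOfUnit K n
        (unitsVal K (((F ⟨m, by rw [ρ.invariants_ramificationSubgroup_eq_top hur]; trivial⟩ :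
          Representation.invariants ((sUnitsModule K S).toRepresentation.comp (ramificationSubgroup K S).subtype)) :
          sUnitsSubmodule K S) : UnitsCarrier K))
        (unitsVal_pow_eq_one_of_torsion' K S n (nsmul_invariants_eq_zero K S n ρ hM) F _)
    map_zero' := muVal_injective K n (by
      rw [muVal_muOfUnit, muVal_zero]
      have h0 : (⟨(0 : M), by rw [ρ.invariants_ramificationSubgroup_eq_top hur]; trivial⟩ :
          Representation.invariants (ρ.toRepresentation.comp (ramificationSubgroup K S).subtype)) = 0 := rfl
      rw [h0, map_zero]
      rfl)
    map_add' := fun m m' => muVal_injective K n (by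
      rw [muVal_muOfUnit, muVal_add, muVal_muOfUnit, muVal_muOfUnit, ← unitsVal_add]
      have h : (⟨m + m', by rw [ρ.invariants_ramificationSubgroup_eq_top hur]; trivial⟩ :
          Representation.invariants (ρ.toRepresentation.comp (ramificationSubgroup K S).subtype)) =
          ⟨m, by rw [ρ.invariants_ramificationSubgroup_eq_top hur]; trivial⟩ +
          ⟨m', by rw [ρ.invariants_ramificationSubgroup_eq_top hur]; trivial⟩ := rfl
      rw [h, map_add]
      rfl) }

omit [NeZero n] [Finite M] in
/-- `muVal ((tateDualOfHomSUnits F) m) = (F m)` in `K̄ˣ`. [cite: MilneADT2006, I §0 (0.8)] -/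
theorem muVal_tateDualOfHomSUnits_apply (ρ : DiscreteGaloisModule K M) (hM : ∀ m : M, n • m = 0)
    (hur : ramificationSubgroup K S ≤ ContinuousRep.ker ρ)
    (F : ↥(Representation.invariants (ρ.toRepresentation.comp (ramificationSubgroup K S).subtype)) →ₗ[ℤ]
      ↥(Representation.invariants ((sUnitsModule K S).toRepresentation.comp (ramificationSubgroup K S).subtype)))
    (m : Representation.invariants (ρ.toRepresentation.comp (ramificationSubgroup K S).subtype)) :
    muVal K n ((show M →+ MuCarrier K n from tateDualOfHomSUnits K S n ρ hM hur F) (m : M)) =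
      unitsVal K (((F m :
        Representation.invariants ((sUnitsModule K S).toRepresentation.comp (ramificationSubgroup K S).subtype)) :
        sUnitsSubmodule K S) : UnitsCarrier K) := rfl

omit [NumberField K] [Finite M] in
/-- For `N_S ≤ ker ρ`, `ρ τ = id` for `τ ∈ N_S`. [cite: Harari2020, Def. 15.36, Remark 17.7 (b)] -/
theorem apply_eq_self_of_mem_ramificationSubgroup (ρ : DiscreteGaloisModule K M) (hur : ramificationSubgroup K S ≤ ContinuousRep.ker ρ)
    {τ : absoluteGaloisGroup K} (hτ : τ ∈ ramificationSubgroup K S) (m : M) : ρ τ m = m := by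
  rw [(ContinuousRep.mem_ker ρ τ).1 (hur hτ), LinearMap.id_apply]

/-- `tateDualOfHomSUnits F` is `N_S`-invariant in `ρ^D` (`N_S` acts trivially on `M` and on `μₙ`).
[cite: MilneADT2006, I §0 (0.8), I §4 (p. 58)] -/
theorem tateDualOfHomSUnits_mem_invariants (ρ : DiscreteGaloisModule K M)
    (hn : ∀ v : HeightOneSpectrum (𝓞 K), ((n : ℕ) : 𝓞 K) ∈ v.asIdeal → v ∈ S)
    (hM : ∀ m : M, n • m = 0) (hur : ramificationSubgroup K S ≤ ContinuousRep.ker ρ)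
    (F : ↥(Representation.invariants (ρ.toRepresentation.comp (ramificationSubgroup K S).subtype)) →ₗ[ℤ]
      ↥(Representation.invariants ((sUnitsModule K S).toRepresentation.comp (ramificationSubgroup K S).subtype))) :
    tateDualOfHomSUnits K S n ρ hM hur F ∈
      Representation.invariants ((ρ.tateDual n).toRepresentation.comp (ramificationSubgroup K S).subtype) := by
  rw [Representation.mem_invariants]
  intro τ
  refine TateDual.ext fun m => ?_
  change ρ.tateDual n (τ : absoluteGaloisGroup K) (tateDualOfHomSUnits K S n ρ hM hur F) m = _
  rw [tateDual_apply_apply_apply, apply_eq_self_of_mem_ramificationSubgroup K S ρ hur (inv_mem τ.2)]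
  apply muVal_injective K n
  rw [muVal_apply]
  exact Units.ext (by
    rw [Units.coe_smul]
    exact smul_units_eq_self_of_mem_ramificationSubgroup hn _ (muVal_pow_eq_one K n _) _ τ.2)

/-- `Φ_S` is surjective for `M` `n`-torsion with `N_S ≤ ker ρ`. [cite: MilneADT2006, I §0 (0.8), I §4 (p. 58)] -/
theorem tateDualToHomSUnits_surjective (ρ : DiscreteGaloisModule K M)
    (hn : ∀ v : HeightOneSpectrum (𝓞 K), ((n : ℕ) : 𝓞 K) ∈ v.asIdeal → v ∈ S)
    (hM : ∀ m : M, n • m = 0) (hur : ramificationSubgroup K S ≤ ContinuousRep.ker ρ) :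
    Surjective (tateDualToHomSUnits K S n ρ hn) := by
  intro F
  refine ⟨⟨tateDualOfHomSUnits K S n ρ hM hur F, tateDualOfHomSUnits_mem_invariants K S n ρ hn hM hur F⟩, ?_⟩
  refine LinearMap.ext fun m => Subtype.ext (Subtype.ext (unitsVal_injective K ?_))
  rw [coe_coe_tateDualToHomSUnits_apply, unitsVal_kummerInclAddHom]
  exact muVal_tateDualOfHomSUnits_apply K S n ρ hM hur F m

/-- **`Φ_S` is bijective** for `M` `n`-torsion, unramified outside `S` (`N_S ≤ ker ρ`), every prime of `n` in `S`.
[cite: MilneADT2006, I §0 (0.8), I §4 (p. 58)] -/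
theorem tateDualToHomSUnits_bijective (ρ : DiscreteGaloisModule K M)
    (hn : ∀ v : HeightOneSpectrum (𝓞 K), ((n : ℕ) : 𝓞 K) ∈ v.asIdeal → v ∈ S)
    (hM : ∀ m : M, n • m = 0) (hur : ramificationSubgroup K S ≤ ContinuousRep.ker ρ) :
    Bijective (tateDualToHomSUnits K S n ρ hn) :=
  ⟨tateDualToHomSUnits_injective K S n ρ hn hur, tateDualToHomSUnits_surjective K S n ρ hn hM hur⟩

/-! ## §4 The isomorphism of `G_S`-modules and the induced bijections on `Hⁱ(G_S, –)` -/

/-- **`(ρ^D)^{N_S} ≅ Hom_ℤ(M^{N_S}, E_S)` in `TopRep ℤ G_S`** for `M` `n`-torsion, unramified outside `S`, all primes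
of `n` in `S` — the `S`-version of `HomDual.tateDualUnitsIso`. [cite: MilneADT2006, I §0 (0.8), I §4 (p. 58)] -/
def tateDualSUnitsRestrictedIso (ρ : DiscreteGaloisModule K M)
    (hn : ∀ v : HeightOneSpectrum (𝓞 K), ((n : ℕ) : 𝓞 K) ∈ v.asIdeal → v ∈ S)
    (hM : ∀ m : M, n • m = 0) (hur : ramificationSubgroup K S ≤ ContinuousRep.ker ρ) :
    ((ρ.tateDual n).quotientInvariants (ramificationSubgroup K S)).toTopRep ≅
      (homContRep (ρ.quotientInvariants (ramificationSubgroup K S)) (sUnitsRestricted K S)).toTopRep :=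
  topRepIsoOfEquiv (X := ((ρ.tateDual n).quotientInvariants (ramificationSubgroup K S)).toTopRep)
    (Y := (homContRep (ρ.quotientInvariants (ramificationSubgroup K S)) (sUnitsRestricted K S)).toTopRep)
    { (AddEquiv.ofBijective (tateDualToHomSUnits K S n ρ hn)
          (tateDualToHomSUnits_bijective K S n ρ hn hM hur)).toIntLinearEquiv with
      continuous_toFun := continuous_of_discreteTopology
      continuous_invFun := continuous_of_discreteTopology }
    fun g f => tateDualToHomSUnits_smul K S n ρ hn g f

/-- Unfolding `tateDualSUnitsRestrictedIso` on elements: it is `Φ_S`. [cite: MilneADT2006, I §0 (0.8), I §4 (p. 58)] -/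
@[simp] theorem tateDualSUnitsRestrictedIso_hom_apply (ρ : DiscreteGaloisModule K M)
    (hn : ∀ v : HeightOneSpectrum (𝓞 K), ((n : ℕ) : 𝓞 K) ∈ v.asIdeal → v ∈ S)
    (hM : ∀ m : M, n • m = 0) (hur : ramificationSubgroup K S ≤ ContinuousRep.ker ρ)
    (f : Representation.invariants ((ρ.tateDual n).toRepresentation.comp (ramificationSubgroup K S).subtype)) :
    (tateDualSUnitsRestrictedIso K S n ρ hn hM hur).hom.hom f = tateDualToHomSUnits K S n ρ hn f := rfl

/-- `Hⁱ(G_S, (ρ^D)^{N_S}) → Hⁱ(G_S, Hom_ℤ(M^{N_S}, E_S))` is bijective. [cite: MilneADT2006, I §0 (0.8), I §4 (p. 58)] -/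
theorem cohomologyMap_tateDualSUnitsRestrictedIso_bijective (ρ : DiscreteGaloisModule K M)
    (hn : ∀ v : HeightOneSpectrum (𝓞 K), ((n : ℕ) : 𝓞 K) ∈ v.asIdeal → v ∈ S)
    (hM : ∀ m : M, n • m = 0) (hur : ramificationSubgroup K S ≤ ContinuousRep.ker ρ) (q : ℕ) :
    Bijective (cohomologyMap (tateDualSUnitsRestrictedIso K S n ρ hn hM hur).hom q) :=
  (continuousCohomologyEquivOfIso (tateDualSUnitsRestrictedIso K S n ρ hn hM hur) q).bijective

/-- `Hⁱ(G_S, Hom_ℤ(M^{N_S}, E_S)) → Hⁱ(G_S, (ρ^D)^{N_S}) = restrictedCohomology (ρ.tateDual n) S i` is bijective.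
[cite: MilneADT2006, I §0 (0.8), I §4 (p. 58)] -/
theorem cohomologyMap_tateDualSUnitsRestrictedIso_inv_bijective (ρ : DiscreteGaloisModule K M)
    (hn : ∀ v : HeightOneSpectrum (𝓞 K), ((n : ℕ) : 𝓞 K) ∈ v.asIdeal → v ∈ S)
    (hM : ∀ m : M, n • m = 0) (hur : ramificationSubgroup K S ≤ ContinuousRep.ker ρ) (q : ℕ) :
    Bijective (cohomologyMap (tateDualSUnitsRestrictedIso K S n ρ hn hM hur).inv q :
      _ → restrictedCohomology (ρ.tateDual n) S q) :=
  (continuousCohomologyEquivOfIso (tateDualSUnitsRestrictedIso K S n ρ hn hM hur) q).symm.bijective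

/-- `Hⁱ(e.hom) (Hⁱ(e.inv) y) = y` for `e = tateDualSUnitsRestrictedIso`. [cite: MilneADT2006, I §0 (0.8), I §4 (p. 58)] -/
theorem cohomologyMap_tateDualSUnitsRestrictedIso_hom_inv_apply (ρ : DiscreteGaloisModule K M)
    (hn : ∀ v : HeightOneSpectrum (𝓞 K), ((n : ℕ) : 𝓞 K) ∈ v.asIdeal → v ∈ S)
    (hM : ∀ m : M, n • m = 0) (hur : ramificationSubgroup K S ≤ ContinuousRep.ker ρ) (q : ℕ)
    (y : continuousCohomology q
      (homContRep (ρ.quotientInvariants (ramificationSubgroup K S)) (sUnitsRestricted K S)).toTopRep) :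
    cohomologyMap (tateDualSUnitsRestrictedIso K S n ρ hn hM hur).hom q
      (cohomologyMap (tateDualSUnitsRestrictedIso K S n ρ hn hM hur).inv q y) = y :=
  cohomologyMap_inv_hom_apply (tateDualSUnitsRestrictedIso K S n ρ hn hM hur).symm q y

/-- `Hⁱ(e.inv) (Hⁱ(e.hom) x) = x` for `e = tateDualSUnitsRestrictedIso`. [cite: MilneADT2006, I §0 (0.8), I §4 (p. 58)] -/
theorem cohomologyMap_tateDualSUnitsRestrictedIso_inv_hom_apply (ρ : DiscreteGaloisModule K M)
    (hn : ∀ v : HeightOneSpectrum (𝓞 K), ((n : ℕ) : 𝓞 K) ∈ v.asIdeal → v ∈ S)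
    (hM : ∀ m : M, n • m = 0) (hur : ramificationSubgroup K S ≤ ContinuousRep.ker ρ) (q : ℕ)
    (x : restrictedCohomology (ρ.tateDual n) S q) :
    cohomologyMap (tateDualSUnitsRestrictedIso K S n ρ hn hM hur).inv q
      (cohomologyMap (tateDualSUnitsRestrictedIso K S n ρ hn hM hur).hom q x) = x :=
  cohomologyMap_inv_hom_apply (tateDualSUnitsRestrictedIso K S n ρ hn hM hur) q x

end ContHomDual

end Literature.NumberTheory.GaloisRepresentations

end
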